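import Mathlib
import Summits.Langlands.Langlands.Theorems.ParityBlindBianchiIcosahedralQuadraticDescentFrobRoots
import Literature.NumberTheory.Automorphic.TunnellLemma
import Literature.NumberTheory.Automorphic.BaseChangeStrongUnramified
import Literature.NumberTheory.Automorphic.AutomorphicRepsGLSatakeFlathProofs

/-!
# Icosahedral descent (crux `IcosahedralDescentLevel`, line `Sketch`) — the read-off at a split place

Uniform quadratic descent for an Artin representation `ρ : Γ_ℚ → GL₂(ℂ)`, the read-off step.
`K/ℚ` is a quadratic Galois extension (prime degree, hence cyclic), `x` a cuspidal representation
of `GL₂(𝔸_ℚ)` and `P` a cuspidal representation of `GL₂(𝔸_K)` which is a weak (almost-everywhere)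
base-change lift of `x` (`IsWeakBaseChangeLiftAE`).  Let `v` be a finite place of `ℚ` unramified
in `K` and split (every place `w ∣ v` of `K` has residue degree `f(w|v) = 1`), `ρ` unramified at
`v`, and `P` Frobenius–Satake compatible with `ρ|_{Γ_K}` at every `w ∣ v`
(`FrobSatakeCompatibleAt`).  Then `x` is Frobenius–Satake compatible with `ρ` at `v`:

* Arthur–Clozel's strong lifting at the places unramified in `K` (the named fact
  `ArthurClozel1989_strongLifting_unramified`, A–C III.5.1, taken as a hypothesis) makes the weak
  lift exact at `v`: `x` is unramified at `v` (projection (ii), since `P` is unramified at every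
  `w ∣ v`) with Satake parameter `α₀`, and `t_{P,w} = α₀^{f(w|v)} = α₀` at a place `w ∣ v`
  (projection (i));
* compatibility of Frobenius data under restriction (`satakeParam_eq_frob_pow`) gives
  `t_{P,w} = β^{f(w|v)} = β` for `β = frobRoots ρ v` the Frobenius eigenvalues of `ρ` at `v`;
* hence `α₀ = β`, i.e. `x` has Satake parameter `β` at `v`, whose Satake polynomial is the
  Frobenius characteristic polynomial of `ρ` at `v` (`card_frobRoots_and_hasFrobCharpolyAt`).
-/

-- `Summit.Langlands.Langlands.…`: the repeated path component is the tree's layout (D-0017).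
set_option linter.dupNamespace false

noncomputable section

open scoped MatrixGroups NumberField Polynomial Classical
open NumberField IsDedekindDomain Field Filter
open Literature.NumberTheory.Automorphic Literature.NumberTheory.GaloisRepresentations
open Summit.Langlands.Langlands.Theorems.IcosahedralQuadraticDescent

namespace Summit.Langlands.Langlands.Theorems.IcosahedralDescentLevel

/-- **Strong lifting read at a split place.**  If `P` (cuspidal on `GL₂(𝔸_K)`, `K/ℚ` quadratic
Galois) is a weak base-change lift of the cuspidal `x` on `GL₂(𝔸_ℚ)`, `v` is unramified in `K`
with all places above it of residue degree `1`, `ρ` is unramified at `v`, and `P` is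
Frobenius–Satake compatible with `ρ|_{Γ_K}` at every place above `v`, then `x` is Frobenius–Satake
compatible with `ρ` at `v` (Arthur–Clozel III.5.1 at the unramified place `v`:
`t_{P,w} = t_{x,v}^{f(w|v)} = t_{x,v}` at every `w ∣ v`, and `t_{P,w} = β_v^{f(w|v)} = β_v` for the
Frobenius eigenvalues `β_v` of `ρ` at `v`). [folklore] -/
theorem frobSatakeCompatibleAt_of_weakLift_split (hSL : ArthurClozel1989_strongLifting_unramified) (ρ : FramedArtinRep ℚ 2)
    (K : Type) [Field K] [NumberField K] [IsGalois ℚ K] (h2 : Module.finrank ℚ K = 2)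
    (hQ : isCompact_glFiniteIntegralLevel 2 ℚ) (hK : isCompact_glFiniteIntegralLevel 2 K)
    (x : CuspidalAutomorphicRepData 2 ℚ hQ) (P : CuspidalAutomorphicRepData 2 K hK)
    (hlift : IsWeakBaseChangeLiftAE x.1 P.1) (v : HeightOneSpectrum (𝓞 ℚ))
    (hunr : Algebra.IsUnramifiedIn (𝓞 K) v.asIdeal)
    (hdeg : ∀ w : HeightOneSpectrum (𝓞 K), w.asIdeal.under (𝓞 ℚ) = v.asIdeal →
      w.asIdeal.inertiaDeg (𝓞 ℚ) = 1)
    (hρ : ρ.IsUnramifiedAt v)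
    (hcompat : ∀ w : HeightOneSpectrum (𝓞 K), w.asIdeal.under (𝓞 ℚ) = v.asIdeal →
      FrobSatakeCompatibleAt (ρ.restrictField K) P.1 w) :
    FrobSatakeCompatibleAt ρ x.1 v := by
  have hprime : (Module.finrank ℚ K).Prime := by rw [h2]; exact Nat.prime_two
  -- (a) `x` is unramified at `v`: `P` is unramified at every `w ∣ v` (strong lifting, (ii))
  obtain ⟨α₀, hα₀⟩ : x.1.IsUnramifiedAt v :=
    hSL.isUnramifiedAt_of_forall hprime hlift hunr fun w hw =>
      (hcompat w hw).imp fun _ h => h.1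
  -- (b) at a place `w ∣ v`: `t_{P,w} = α₀^{f(w|v)}` (strong lifting, (i))
  obtain ⟨w, hw⟩ := exists_above (E := K) v
  have hPw := hSL.hasSatakeParamAt_pow hprime hlift hw hunr hα₀
  -- (c) `t_{P,w} = β^{f(w|v)}` for the Frobenius eigenvalues `β` of `ρ` at `v`, and `f(w|v) = 1`
  obtain ⟨hβcard, hPv⟩ := card_frobRoots_and_hasFrobCharpolyAt ρ hρ
  have e := satakeParam_eq_frob_pow ρ hρ hβcard hPv
    (AutomorphicRepData.hasSatakeParamAt_unique_holds P.1) hw (hcompat w hw) hPw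
  rw [hdeg w hw] at e
  simp only [pow_one, Multiset.map_id'] at e
  exact ⟨frobRoots ρ v, e ▸ hα₀, hρ, hPv⟩

end Summit.Langlands.Langlands.Theorems.IcosahedralDescentLevel

end
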